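/-
Copyright (c) 2026. All rights reserved.
Released under Apache 2.0 license as described in the file LICENSE.
Authors: abc-iut cell, seat abc-iut-L4-t10 (gen 4; geometric `EA` column of [AbsTopIII] Prop 4.2 (i) /
Cor 4.5 — consumer of abc-iut-w5-d144's unconditional id-rigidity at once-punctured elliptic curves).
-/
import Literature.AnabelianGeometry.AbsoluteAnabelian.ArchimedeanHolFieldFunctorGeometricPuncturedEllipticOuter
import Literature.AnabelianGeometry.AbsoluteAnabelian.ArchimedeanHolFieldFunctorGeometricTripodCovers
import Literature.AnabelianGeometry.AbsoluteAnabelian.AbsTopIII.AutHolLogFrobeniusCor45FullModelProofs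
import HarnessLib

/-!
# [AbsTopIII] Prop 4.2 (i) / Cor 4.5 at the geometric `EA` of everything finite étale over a
# once-punctured elliptic curve — no residual hypothesis

S. Mochizuki, *Topics in Absolute Anabelian Geometry III*, proof of Prop. 4.2 (i), kurims p.106 l.11–19;
Cor. 4.5 pp.107–109; Cor. 2.7 (a) p.58 (once-punctured elliptic curves).
[cite: MochizukiAbsTopIII2015, Proposition 4.2 (i) p.106]

PROOF-ONLY consumer (seat abc-iut-L4-t10 gen 4).  abc-iut-w5-d144's
`ArchimedeanHolFieldFunctorGeometricPuncturedTorusOuter` / `…PuncturedEllipticOuter`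
(`HolRS.isIdRigid_mapsTo_puncturedTorus`, `HolRS.isIdRigid_mapsTo_of_isPuncturedEllipticCurve`) prove
«objects of `HolRS` mapping to `𝕏`» id-rigid, UNCONDITIONALLY, for `𝕏` a punctured complex torus
`ℂ/Φ(ℤ²) ∖ {x₀}` and for every `𝕏` whose carrier is a once-punctured elliptic curve
(`IsPuncturedEllipticCurve`).  This file reads them through this seat's geometric Cor 4.5 column
(`cor_4_5_geometric`, `isIdRigid_pairs_of_isIdRigid_EA`, `cor_4_5_full_geometric_iff`):

* `HolRS.isIdRigid_EA_puncturedTorusCovers`, `HolRS.isIdRigid_EA_mapsTo_of_isPuncturedEllipticCurve` —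
  `EA^hol_RS(Q_𝕏)` is id-rigid;
* `HolRS.isIdRigid_pairs_puncturedTorusCovers` — Prop 4.2 (i): `𝒞^hol_TF`, `𝒞^hol_T` over it;
* `HolRS.cor_4_5_geometric_puncturedTorusCovers`, `HolRS.cor_4_5_geometric_mapsTo_of_isPuncturedEllipticCurve`
  — **Cor 4.5 (i)(ii)(iv) + the (iii)-cores and (v) clauses AS TYPED (`AbsTopIII.Cor_4_5`)** for the
  archimedean log-Frobenius data over `EA^hol_RS(Q_𝕏)`, every punctured torus / once-punctured elliptic
  curve `𝕏` — ZERO residual hypotheses;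
* `HolRS.cor_4_5_full_geometric_puncturedTorusCovers_iff` — there, `Cor_4_5_full` ⟺ the telecore half
  of (iii) (`LogObsCompatTelecoreStmt`).

Together with `ArchimedeanHolFieldFunctorGeometricTripodCovers` (tripod / `ℂ ∖ {p,q}`) this covers the
two minimal hyperbolic types `(0,3)` and `(1,1)` at the model with no hypothesis.  HONEST SCOPE: model
level (OUR `HolRS`); model ≠ reconstruction; support library, not a node; nothing here bears on
[IUTchIII] Cor. 3.12.  No definitions, no instances, no named facts.
-/

noncomputable section

open CategoryTheory
open Literature.Topology.CoveringSpaces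
open Literature.Geometry.Kaehler Literature.Geometry.Kaehler.ComplexTorus

namespace Literature.AnabelianGeometry.AbsoluteAnabelian

namespace HolRS

variable (Φ : (Fin 2 → ℝ) ≃L[ℝ] ℂ)

/-! ### The punctured complex torus `ℂ/Φ(ℤ²) ∖ {x₀}` -/

/-- **`EA^hol_RS(Q_{ℂ/Φ(ℤ²)∖{x₀}})` is id-rigid** (abc-iut-w5-d144's `isIdRigid_mapsTo_puncturedTorus`,
read as a statement about the `EA` of the geometric interface datum).
[cite: MochizukiAbsTopIII2015, Proposition 4.2 (i) p.106] -/
theorem isIdRigid_EA_puncturedTorusCovers (x₀ : ComplexTorus Φ) :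
    IsIdRigid (geometricAutHolFieldFunctor (fun Y : HolRS =>
      Nonempty (Y ⟶ puncturedTorus Φ x₀))).EA :=
  isIdRigid_mapsTo_puncturedTorus Φ x₀

/-- **Prop 4.2 (i): `𝒞^hol_TF` and `𝒞^hol_T` over `EA^hol_RS(Q_{ℂ/Φ(ℤ²)∖{x₀}})` are id-rigid.**
[cite: MochizukiAbsTopIII2015, Proposition 4.2 (i) p.105] -/
theorem isIdRigid_pairs_puncturedTorusCovers (x₀ : ComplexTorus Φ)
    {T : ArchPairType} (hT : T.IsMonoidType) :
    IsIdRigid (HolTFPair (geometricAutHolFieldFunctor (fun Y : HolRS =>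
      Nonempty (Y ⟶ puncturedTorus Φ x₀)))) ∧
    IsIdRigid (HolMonoidPair (geometricAutHolFieldFunctor (fun Y : HolRS =>
      Nonempty (Y ⟶ puncturedTorus Φ x₀))) T) :=
  isIdRigid_pairs_of_isIdRigid_EA _ (isIdRigid_EA_puncturedTorusCovers Φ x₀) hT

/-- **[AbsTopIII] Cor 4.5 (i)(ii)(iv) with the (iii)-cores and (v) clauses AS TYPED (`AbsTopIII.Cor_4_5`)
for the archimedean log-Frobenius data over `EA^hol_RS(Q_{ℂ/Φ(ℤ²)∖{x₀}})`**, every lattice `Φ` and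
puncture `x₀` — no residual hypothesis. [cite: MochizukiAbsTopIII2015, Corollary 4.5 pp.107–109] -/
theorem cor_4_5_geometric_puncturedTorusCovers (x₀ : ComplexTorus Φ) :
    AbsTopIII.Cor_4_5
      (archLogFrobeniusData (geometricAutHolFieldFunctor (fun Y : HolRS =>
        Nonempty (Y ⟶ puncturedTorus Φ x₀))))
      (archTelecoreData (geometricAutHolFieldFunctor (fun Y : HolRS =>
        Nonempty (Y ⟶ puncturedTorus Φ x₀)))) :=
  cor_4_5_geometric _ ⟨puncturedTorus Φ x₀, ⟨𝟙 _⟩⟩ (isIdRigid_EA_puncturedTorusCovers Φ x₀)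

/-- **`Cor_4_5_full` over `EA^hol_RS(Q_{ℂ/Φ(ℤ²)∖{x₀}})` ⟺ the telecore half of (iii)**
(`LogObsCompatTelecoreStmt`). [cite: MochizukiAbsTopIII2015, Corollary 4.5 pp.107–109] -/
theorem cor_4_5_full_geometric_puncturedTorusCovers_iff (x₀ : ComplexTorus Φ) :
    AbsTopIII.Cor_4_5_full
        (archLogFrobeniusData (geometricAutHolFieldFunctor (fun Y : HolRS =>
          Nonempty (Y ⟶ puncturedTorus Φ x₀))))
        (archTelecoreData (geometricAutHolFieldFunctor (fun Y : HolRS =>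
          Nonempty (Y ⟶ puncturedTorus Φ x₀)))) ↔
      (archLogFrobeniusData (geometricAutHolFieldFunctor (fun Y : HolRS =>
          Nonempty (Y ⟶ puncturedTorus Φ x₀)))).LogObsCompatTelecoreStmt
        (archTelecoreData (geometricAutHolFieldFunctor (fun Y : HolRS =>
          Nonempty (Y ⟶ puncturedTorus Φ x₀)))) :=
  cor_4_5_full_geometric_iff _ ⟨puncturedTorus Φ x₀, ⟨𝟙 _⟩⟩ (isIdRigid_EA_puncturedTorusCovers Φ x₀)

/-! ### Every once-punctured elliptic curve -/

/-- **`EA^hol_RS(Q_𝕏)` is id-rigid for every `𝕏 : HolRS` whose carrier is a once-punctured elliptic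
curve** (abc-iut-w5-d144's `isIdRigid_mapsTo_of_isPuncturedEllipticCurve`).
[cite: MochizukiAbsTopIII2015, Proposition 4.2 (i) p.106] -/
theorem isIdRigid_EA_mapsTo_of_isPuncturedEllipticCurve (X : HolRS)
    (hX : TorsionPointsDenseUniqueGroupLaw.IsPuncturedEllipticCurve X.carrier) :
    IsIdRigid (geometricAutHolFieldFunctor (fun Y : HolRS => Nonempty (Y ⟶ X))).EA :=
  X.isIdRigid_mapsTo_of_isPuncturedEllipticCurve hX

/-- **[AbsTopIII] Cor 4.5 AS TYPED (`AbsTopIII.Cor_4_5`) over `EA^hol_RS(Q_𝕏)` for every once-punctured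
elliptic curve `𝕏`** — no residual hypothesis. [cite: MochizukiAbsTopIII2015, Corollary 4.5 pp.107–109]
[cite: MochizukiAbsTopIII2015, Corollary 2.7 (a) p.58] -/
theorem cor_4_5_geometric_mapsTo_of_isPuncturedEllipticCurve (X : HolRS)
    (hX : TorsionPointsDenseUniqueGroupLaw.IsPuncturedEllipticCurve X.carrier) :
    AbsTopIII.Cor_4_5
      (archLogFrobeniusData (geometricAutHolFieldFunctor (fun Y : HolRS => Nonempty (Y ⟶ X))))
      (archTelecoreData (geometricAutHolFieldFunctor (fun Y : HolRS => Nonempty (Y ⟶ X)))) :=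
  cor_4_5_geometric _ ⟨X, ⟨𝟙 X⟩⟩ (isIdRigid_EA_mapsTo_of_isPuncturedEllipticCurve X hX)

/-- **`Cor_4_5_full` over `EA^hol_RS(Q_𝕏)` ⟺ the telecore half of (iii)**, every once-punctured
elliptic curve `𝕏`. [cite: MochizukiAbsTopIII2015, Corollary 4.5 pp.107–109] -/
theorem cor_4_5_full_geometric_mapsTo_iff_of_isPuncturedEllipticCurve (X : HolRS)
    (hX : TorsionPointsDenseUniqueGroupLaw.IsPuncturedEllipticCurve X.carrier) :
    AbsTopIII.Cor_4_5_full
        (archLogFrobeniusData (geometricAutHolFieldFunctor (fun Y : HolRS => Nonempty (Y ⟶ X))))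
        (archTelecoreData (geometricAutHolFieldFunctor (fun Y : HolRS => Nonempty (Y ⟶ X)))) ↔
      (archLogFrobeniusData
        (geometricAutHolFieldFunctor (fun Y : HolRS => Nonempty (Y ⟶ X)))).LogObsCompatTelecoreStmt
        (archTelecoreData (geometricAutHolFieldFunctor (fun Y : HolRS => Nonempty (Y ⟶ X)))) :=
  cor_4_5_full_geometric_iff _ ⟨X, ⟨𝟙 X⟩⟩ (isIdRigid_EA_mapsTo_of_isPuncturedEllipticCurve X hX)

end HolRS

end Literature.AnabelianGeometry.AbsoluteAnabelian
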